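import Literature.MathematicalPhysics.QuantumManyBody.JelliumBackgroundExpansion
import Literature.MathematicalPhysics.QuantumManyBody.JelliumBochnerFibre
import HarnessLib

/-!
# Lieb–Solovej Lemma 5.5 (control of the terms with `ŵ_{p0,00}`) in first quantization

Topic `Literature/MathematicalPhysics/QuantumManyBody` (the charged Bose gas, `JelliumBoseGas.foldyLaw`).
[LiebSolovej2001, Lemma 5.5]: the terms with exactly one nonzero index,
`∑_{p≠0} ŵ_{p0,00}((n̂₀ - ρℓ³)a*_pa₀ + h.c.)`, are bounded below by
`-ε⁻¹4πℓ⁻³R² n̂₀n̂₊ - εŵ_{00,00}(n̂₀ + 1 - ρℓ³)²` for all `ε > 0`.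

First quantization (`n+1` particles, `Λ = cell ℓ`, symmetric pair weight `0 ≤ w ≤ W_b`,
`m(x) = ∫_Λ w(y,x)dy`, particle `j`): the one-`Q` blocks of the pairs containing `j`,
`∑_{i≠j}Re∫_{Λⁿ⁺¹} w(xᵢ,xⱼ) conj(PᵢPⱼΨ)(PᵢQⱼΨ)` (`R₀₁` of `JelliumPairBlocks`), and the cross term of the
background `ρRe∫m(xⱼ)conj(PⱼΨ)QⱼΨ` (`JelliumBackgroundExpansion`) combine, by dummy integration of `xᵢ`
and the self-adjointness of `Pᵢ`, into `Re∫ m(xⱼ) conj(Aⱼ) QⱼΨ` with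
`Aⱼ = (ℓ⁻³N̂ⱼ - ρ)PⱼΨ`, `N̂ⱼ = ∑_{i≠j}Pᵢ` (`one_Q_combination`); Cauchy–Schwarz and the dummy integration
of `xⱼ` then give (`ls_lemma55`)

`|∑_{i≠j}Re∫w conj(PᵢPⱼΨ)(PᵢQⱼΨ) - ρRe∫m conj(PⱼΨ)QⱼΨ| ≤ ½(εℓ⁻³(∫_Λm)‖Aⱼ‖² + ε⁻¹∫m(xⱼ)|QⱼΨ|²)`,

the printed `εŵ_{00,00}(n̂₀+1-ρℓ³)²`- and `ε⁻¹·(sup m)·n̂₊`-shaped errors (`∫_Λm = ℓ⁶ŵ_{00,00}`; take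
`ε ↦ ερ⁻¹` to compare with `ε⁻¹4πℓ⁻³R²n̂₀n̂₊`).

## References

* [LiebSolovej2001] E. H. Lieb, J. P. Solovej, Commun. Math. Phys. 217 (2001) 127–163, Lemma 5.5
  (arXiv:cond-mat/0007425, pp. 12–13).
-/

noncomputable section

open MeasureTheory Set Filter Real
open scoped ENNReal NNReal Topology ComplexConjugate

namespace Literature.MathematicalPhysics.QuantumManyBody.JelliumBoseGas

open BoseGas

variable {n : ℕ} {ℓ : ℝ}

/-! ### A two-argument Bochner dummy integration -/

/-- **Bochner dummy integration with a weight depending on another variable**: for a jointly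
measurable bounded real weight `G(X,y)` independent of `xᵢ` in its first argument, and a measurable
`K` bounded on `Λⁿ⁺¹` and independent of `xᵢ` (`ℓ > 0`),
`∫_{Λⁿ⁺¹} G(X,xᵢ)K(X) dX = ℓ⁻³ ∫_{Λⁿ⁺¹} (∫_Λ G(X,y)dy) K(X) dX`. [cite: LiebSolovej2001, Lemma 5.5 (proof)] -/
theorem integral_cellN_weight₂_of_update_invariant (hℓ : 0 < ℓ) (i : Fin (n + 1))
    {G : Config (n + 1) → Space → ℝ} (hG : Measurable (Function.uncurry G)) {Gb : ℝ}
    (hGb : ∀ X y, |G X y| ≤ Gb) (hGi : ∀ X y z, G (Function.update X i z) y = G X y)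
    {K : Config (n + 1) → ℂ} (hKm : Measurable K) {C : ℝ} (hC : ∀ X ∈ cellN (n + 1) ℓ, ‖K X‖ ≤ C)
    (hKi : ∀ X z, K (Function.update X i z) = K X) :
    ∫ X in cellN (n + 1) ℓ, (G X (X i) : ℂ) * K X =
      ((ℓ ^ 3)⁻¹ : ℝ) • ∫ X in cellN (n + 1) ℓ, ((∫ y in cell ℓ, G X y : ℝ) : ℂ) * K X := by
  have hvol : volume (cellN (n + 1) ℓ) ≠ ⊤ := by
    rw [volume_cellN]; exact ENNReal.pow_ne_top (ENNReal.pow_ne_top ENNReal.ofReal_ne_top)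
  haveI := isFiniteMeasure_restrict_cell ℓ
  have hGb0 : 0 ≤ Gb := (abs_nonneg _).trans (hGb 0 0)
  -- integrability of `G(X,xᵢ)K`
  have hGXi : Measurable fun X : Config (n + 1) => G X (X i) :=
    hG.comp (measurable_id.prodMk (measurable_pi_apply i))
  have hm : Measurable fun X : Config (n + 1) => (G X (X i) : ℂ) * K X :=
    (Complex.measurable_ofReal.comp hGXi).mul hKm
  have hint : IntegrableOn (fun X : Config (n + 1) => (G X (X i) : ℂ) * K X) (cellN (n + 1) ℓ) := by
    refine Measure.integrableOn_of_bounded (M := Gb * C) hvol hm.aestronglyMeasurable ?_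
    refine (ae_restrict_iff' (measurableSet_cellN _ _)).2 (Eventually.of_forall fun X hX => ?_)
    rw [norm_mul, Complex.norm_real, Real.norm_eq_abs]
    exact mul_le_mul (hGb _ _) (hC X hX) (norm_nonneg _) hGb0
  have h := integral_cellN_integral_cell_update i hint
  have hfib : ∀ X : Config (n + 1), ∫ y in cell ℓ, (G (Function.update X i y) ((Function.update X i y) i) : ℂ) *
      K (Function.update X i y) = ((∫ y in cell ℓ, G X y : ℝ) : ℂ) * K X := by
    intro X
    simp_rw [Function.update_self, hGi, hKi]
    rw [integral_mul_const, integral_complex_ofReal]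
  simp_rw [hfib] at h
  have hℓ3 : (ℓ ^ 3 : ℝ) ≠ 0 := by positivity
  rw [Complex.real_smul] at h
  rw [Complex.real_smul, h, ← mul_assoc]
  push_cast
  rw [inv_mul_cancel₀ (by exact_mod_cast hℓ3), one_mul]

/-! ### The one-`Q` combination -/

section OneQ

variable {w : Space → Space → ℝ} {Ψ : Config (n + 1) → ℂ}

/-- The column integral `m(x) = ∫_Λ w(y,x)dy` of a bounded measurable weight is measurable, nonnegative
for `w ≥ 0`, and bounded by `W_b ℓ³` (`ℓ ≥ 0`). [folklore] -/
theorem column_weight_props (hℓ : 0 ≤ ℓ) (hw : Measurable (Function.uncurry w)) (hw0 : ∀ x y, 0 ≤ w x y)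
    {Wb : ℝ} (hWb : ∀ x y, |w x y| ≤ Wb) :
    Measurable (fun x => ∫ y in cell ℓ, w y x) ∧ (∀ x, 0 ≤ ∫ y in cell ℓ, w y x) ∧
      ∀ x, |∫ y in cell ℓ, w y x| ≤ Wb * ℓ ^ 3 := by
  haveI := isFiniteMeasure_restrict_cell ℓ
  have hWb0 : 0 ≤ Wb := (abs_nonneg _).trans (hWb 0 0)
  refine ⟨?_, fun x => integral_nonneg fun y => hw0 y x, fun x => ?_⟩
  · have hs : StronglyMeasurable (Function.uncurry fun (x y : Space) => w y x) :=
      (hw.comp measurable_swap).stronglyMeasurable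
    exact (hs.integral_prod_right' (ν := volume.restrict (cell ℓ))).measurable
  · rw [abs_of_nonneg (integral_nonneg fun y => hw0 y x)]
    calc ∫ y in cell ℓ, w y x ≤ ∫ _ in cell ℓ, Wb := by
          refine integral_mono_of_nonneg (Eventually.of_forall fun y => hw0 y x) (integrable_const _)
            (Eventually.of_forall fun y => (le_abs_self _).trans (hWb y x))
      _ = Wb * ℓ ^ 3 := by rw [setIntegral_const, smul_eq_mul, volume_real_cell hℓ, mul_comm]

/-- **The one-`Q` pair block of the pair `(i,j)` through `m`**: for `i ≠ j`, `ℓ > 0`, a bounded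
measurable weight `w ≥ 0` and continuous `Ψ`,
`∫_{Λⁿ⁺¹} w(xᵢ,xⱼ) conj(PᵢPⱼΨ)(PᵢQⱼΨ) = ℓ⁻³∫_{Λⁿ⁺¹} m(xⱼ) conj(PᵢPⱼΨ) QⱼΨ`, `m(x) = ∫_Λ w(y,x)dy`
(dummy integration of `xᵢ`, then `⟨PᵢF, m PᵢG⟩ = ⟨PᵢF, m G⟩`). [cite: LiebSolovej2001, Lemma 5.5] -/
theorem one_Q_block_eq (hℓ : 0 < ℓ) {i j : Fin (n + 1)} (hij : i ≠ j) (hw : Measurable (Function.uncurry w))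
    (hw0 : ∀ x y, 0 ≤ w x y) {Wb : ℝ} (hWb : ∀ x y, |w x y| ≤ Wb) (hΨ : Continuous Ψ) :
    ∫ X in cellN (n + 1) ℓ, (w (X i) (X j) : ℂ) *
        (conj (sliceMean ℓ i (sliceMean ℓ j Ψ) X) * sliceMean ℓ i (sliceFluct ℓ j Ψ) X) =
      ((ℓ ^ 3)⁻¹ : ℝ) • ∫ X in cellN (n + 1) ℓ, ((∫ y in cell ℓ, w y (X j) : ℝ) : ℂ) *
        (conj (sliceMean ℓ i (sliceMean ℓ j Ψ) X) * sliceFluct ℓ j Ψ X) := by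
  obtain ⟨hmm, hm0, hmb⟩ := column_weight_props hℓ.le hw hw0 hWb
  -- the pieces and their invariances
  have hPP : Continuous (sliceMean ℓ i (sliceMean ℓ j Ψ)) := continuous_sliceMean ℓ i (continuous_sliceMean ℓ j hΨ)
  have hPQ : Continuous (sliceMean ℓ i (sliceFluct ℓ j Ψ)) := continuous_sliceMean ℓ i (continuous_sliceFluct ℓ j hΨ)
  have hQ : Continuous (sliceFluct ℓ j Ψ) := continuous_sliceFluct ℓ j hΨ
  have hPPi : ∀ X z, sliceMean ℓ i (sliceMean ℓ j Ψ) (Function.update X i z) = sliceMean ℓ i (sliceMean ℓ j Ψ) X :=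
    fun X z => sliceMean_update ℓ i _ X z
  have hPQi : ∀ X z, sliceMean ℓ i (sliceFluct ℓ j Ψ) (Function.update X i z) = sliceMean ℓ i (sliceFluct ℓ j Ψ) X :=
    fun X z => sliceMean_update ℓ i _ X z
  -- step 1: dummy integration of `xᵢ`
  set K : Config (n + 1) → ℂ := fun X => conj (sliceMean ℓ i (sliceMean ℓ j Ψ) X) *
    sliceMean ℓ i (sliceFluct ℓ j Ψ) X with hK
  have hKm : Measurable K := (Complex.continuous_conj.measurable.comp hPP.measurable).mul hPQ.measurable
  obtain ⟨C1, hC1⟩ := (isCompact_closedCubeN (n + 1) ℓ).exists_bound_of_continuousOn hPP.continuousOn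
  obtain ⟨C2, hC2⟩ := (isCompact_closedCubeN (n + 1) ℓ).exists_bound_of_continuousOn hPQ.continuousOn
  have hKb : ∀ X ∈ cellN (n + 1) ℓ, ‖K X‖ ≤ C1 * C2 := fun X hX => by
    rw [hK]; simp only [norm_mul, Complex.norm_conj]
    exact mul_le_mul (hC1 X (cellN_subset_closedCubeN _ _ hX)) (hC2 X (cellN_subset_closedCubeN _ _ hX))
      (norm_nonneg _) ((norm_nonneg _).trans (hC1 X (cellN_subset_closedCubeN _ _ hX)))
  have hKi : ∀ X z, K (Function.update X i z) = K X := fun X z => by simp only [hK, hPPi, hPQi]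
  have hGm : Measurable (Function.uncurry fun (X : Config (n + 1)) (y : Space) => w y (X j)) := by
    have e : (Function.uncurry fun (X : Config (n + 1)) (y : Space) => w y (X j)) =
        Function.uncurry w ∘ fun p : Config (n + 1) × Space => (p.2, p.1 j) := rfl
    rw [e]; exact hw.comp (by fun_prop)
  have h1 := integral_cellN_weight₂_of_update_invariant hℓ i (G := fun X y => w y (X j)) hGm
    (fun X y => hWb y (X j)) (fun X y z => by simp only [Function.update_of_ne (Ne.symm hij)]) hKm hKb hKi
  simp only [hK] at h1
  rw [h1]
  congr 1
  -- step 2: drop the `Pᵢ` in front of `QⱼΨ`: `H = m(xⱼ)·PᵢPⱼΨ` is `xᵢ`-free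
  have hH : ∀ X y, (fun X => ((∫ y in cell ℓ, w y (X j) : ℝ) : ℂ) * sliceMean ℓ i (sliceMean ℓ j Ψ) X)
      (Function.update X i y) = (fun X => ((∫ y in cell ℓ, w y (X j) : ℝ) : ℂ) *
        sliceMean ℓ i (sliceMean ℓ j Ψ) X) X := fun X y => by
    simp only [Function.update_of_ne (Ne.symm hij), hPPi]
  have hHG : IntegrableOn (fun X => conj (((∫ y in cell ℓ, w y (X j) : ℝ) : ℂ) *
      sliceMean ℓ i (sliceMean ℓ j Ψ) X) * sliceFluct ℓ j Ψ X) (cellN (n + 1) ℓ) := by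
    have hvol : volume (cellN (n + 1) ℓ) ≠ ⊤ := by
      rw [volume_cellN]; exact ENNReal.pow_ne_top (ENNReal.pow_ne_top ENNReal.ofReal_ne_top)
    obtain ⟨C3, hC3⟩ := (isCompact_closedCubeN (n + 1) ℓ).exists_bound_of_continuousOn hQ.continuousOn
    have hWb0 : 0 ≤ Wb := (abs_nonneg _).trans (hWb 0 0)
    have hmeas : Measurable fun X => conj (((∫ y in cell ℓ, w y (X j) : ℝ) : ℂ) *
        sliceMean ℓ i (sliceMean ℓ j Ψ) X) * sliceFluct ℓ j Ψ X :=
      (Complex.continuous_conj.measurable.comp (((Complex.measurable_ofReal.comp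
        (hmm.comp (measurable_pi_apply j))).mul hPP.measurable))).mul hQ.measurable
    refine Measure.integrableOn_of_bounded (M := Wb * ℓ ^ 3 * C1 * C3) hvol hmeas.aestronglyMeasurable ?_
    refine (ae_restrict_iff' (measurableSet_cellN _ _)).2 (Eventually.of_forall fun X hX => ?_)
    rw [norm_mul, Complex.norm_conj, norm_mul, Complex.norm_real, Real.norm_eq_abs]
    have h3 := hC3 X (cellN_subset_closedCubeN _ _ hX)
    have h1' := hC1 X (cellN_subset_closedCubeN _ _ hX)
    have hm' := hmb (X j)
    have : 0 ≤ ‖sliceMean ℓ i (sliceMean ℓ j Ψ) X‖ := norm_nonneg _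
    have : 0 ≤ ‖sliceFluct ℓ j Ψ X‖ := norm_nonneg _
    have : 0 ≤ |∫ y in cell ℓ, w y (X j)| := abs_nonneg _
    have hC10 : 0 ≤ C1 := (norm_nonneg _).trans h1'
    have : 0 ≤ Wb * ℓ ^ 3 * C1 := by positivity
    calc |∫ y in cell ℓ, w y (X j)| * ‖sliceMean ℓ i (sliceMean ℓ j Ψ) X‖ * ‖sliceFluct ℓ j Ψ X‖
        ≤ (Wb * ℓ ^ 3) * C1 * C3 := by gcongr
      _ = Wb * ℓ ^ 3 * C1 * C3 := by ring
  have h2 := integral_conj_mul_sliceMean hℓ i hH hHG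
  -- massage: `conj(m·PP) = m·conj(PP)` (`m` real)
  have e : ∀ X, conj (((∫ y in cell ℓ, w y (X j) : ℝ) : ℂ) * sliceMean ℓ i (sliceMean ℓ j Ψ) X) =
      ((∫ y in cell ℓ, w y (X j) : ℝ) : ℂ) * conj (sliceMean ℓ i (sliceMean ℓ j Ψ) X) := fun X => by
    rw [map_mul, Complex.conj_ofReal]
  simp_rw [e, mul_assoc] at h2
  exact h2

/-- Products `m(xⱼ)·conj(F)·G` with `m` bounded measurable and `F, G` continuous are integrable on `Λⁿ⁺¹`.
[folklore] -/
theorem integrableOn_weight_conj_mul {m : Space → ℝ} (hm : Measurable m) {Mb : ℝ} (hMb : ∀ y, |m y| ≤ Mb)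
    (j : Fin (n + 1)) {F G : Config (n + 1) → ℂ} (hF : Continuous F) (hG : Continuous G) :
    IntegrableOn (fun X => (m (X j) : ℂ) * (conj (F X) * G X)) (cellN (n + 1) ℓ) := by
  have hvol : volume (cellN (n + 1) ℓ) ≠ ⊤ := by
    rw [volume_cellN]; exact ENNReal.pow_ne_top (ENNReal.pow_ne_top ENNReal.ofReal_ne_top)
  obtain ⟨CF, hCF⟩ := (isCompact_closedCubeN (n + 1) ℓ).exists_bound_of_continuousOn hF.continuousOn
  obtain ⟨CG, hCG⟩ := (isCompact_closedCubeN (n + 1) ℓ).exists_bound_of_continuousOn hG.continuousOn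
  have hMb0 : 0 ≤ Mb := (abs_nonneg _).trans (hMb 0)
  have hmeas : Measurable fun X : Config (n + 1) => (m (X j) : ℂ) * (conj (F X) * G X) :=
    (Complex.measurable_ofReal.comp (hm.comp (measurable_pi_apply j))).mul
      ((Complex.continuous_conj.measurable.comp hF.measurable).mul hG.measurable)
  refine Measure.integrableOn_of_bounded (M := Mb * (CF * CG)) hvol hmeas.aestronglyMeasurable ?_
  refine (ae_restrict_iff' (measurableSet_cellN _ _)).2 (Eventually.of_forall fun X hX => ?_)
  rw [norm_mul, Complex.norm_real, Real.norm_eq_abs, norm_mul, Complex.norm_conj]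
  exact mul_le_mul (hMb _) (mul_le_mul (hCF X (cellN_subset_closedCubeN _ _ hX))
    (hCG X (cellN_subset_closedCubeN _ _ hX)) (norm_nonneg _)
      ((norm_nonneg _).trans (hCF X (cellN_subset_closedCubeN _ _ hX))))
    (mul_nonneg (norm_nonneg _) (norm_nonneg _)) hMb0

/-- **The one-`Q` terms of particle `j` combine into `∫ m(xⱼ) conj(Aⱼ) QⱼΨ`**
[LiebSolovej2001, Lemma 5.5, `∑_p ŵ_{p0,00}((n̂₀-ρℓ³)a*_pa₀ + h.c.)`]: with `m(x) = ∫_Λ w(y,x)dy` and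
`Aⱼ = ℓ⁻³∑_{i≠j}PᵢPⱼΨ - ρPⱼΨ` (`= (ℓ⁻³N̂ⱼ - ρ)PⱼΨ`),
`∑_{i≠j}∫w(xᵢ,xⱼ)conj(PᵢPⱼΨ)(PᵢQⱼΨ) - ρ∫m(xⱼ)conj(PⱼΨ)QⱼΨ = ∫m(xⱼ)conj(Aⱼ)QⱼΨ` (complex integrals on
`Λⁿ⁺¹`). [cite: LiebSolovej2001, Lemma 5.5] -/
theorem one_Q_combination (hℓ : 0 < ℓ) (j : Fin (n + 1)) (hw : Measurable (Function.uncurry w))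
    (hw0 : ∀ x y, 0 ≤ w x y) {Wb : ℝ} (hWb : ∀ x y, |w x y| ≤ Wb) (hΨ : Continuous Ψ) (ρ : ℝ) :
    (∑ i ∈ Finset.univ.erase j, ∫ X in cellN (n + 1) ℓ, (w (X i) (X j) : ℂ) *
        (conj (sliceMean ℓ i (sliceMean ℓ j Ψ) X) * sliceMean ℓ i (sliceFluct ℓ j Ψ) X)) -
      (ρ : ℂ) * ∫ X in cellN (n + 1) ℓ, ((∫ y in cell ℓ, w y (X j) : ℝ) : ℂ) *
        (conj (sliceMean ℓ j Ψ X) * sliceFluct ℓ j Ψ X) =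
      ∫ X in cellN (n + 1) ℓ, ((∫ y in cell ℓ, w y (X j) : ℝ) : ℂ) *
        (conj ((((ℓ ^ 3)⁻¹ : ℝ) : ℂ) * (∑ i ∈ Finset.univ.erase j, sliceMean ℓ i (sliceMean ℓ j Ψ) X) -
            (ρ : ℂ) * sliceMean ℓ j Ψ X) * sliceFluct ℓ j Ψ X) := by
  obtain ⟨hmm, hm0, hmb⟩ := column_weight_props hℓ.le hw hw0 hWb
  have hP : Continuous (sliceMean ℓ j Ψ) := continuous_sliceMean ℓ j hΨ
  have hQ : Continuous (sliceFluct ℓ j Ψ) := continuous_sliceFluct ℓ j hΨ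
  have hPP : ∀ i, Continuous (sliceMean ℓ i (sliceMean ℓ j Ψ)) := fun i => continuous_sliceMean ℓ i hP
  -- each summand through `m`
  rw [Finset.sum_congr rfl fun i hi => one_Q_block_eq hℓ (Finset.ne_of_mem_erase hi) hw hw0 hWb hΨ,
    ← Finset.smul_sum]
  -- sum of integrals = integral of sum
  have hI : ∀ i ∈ Finset.univ.erase j, IntegrableOn (fun X => ((∫ y in cell ℓ, w y (X j) : ℝ) : ℂ) *
      (conj (sliceMean ℓ i (sliceMean ℓ j Ψ) X) * sliceFluct ℓ j Ψ X)) (cellN (n + 1) ℓ) :=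
    fun i _ => integrableOn_weight_conj_mul hmm hmb j (hPP i) hQ
  have hI0 : IntegrableOn (fun X => ((∫ y in cell ℓ, w y (X j) : ℝ) : ℂ) *
      (conj (sliceMean ℓ j Ψ X) * sliceFluct ℓ j Ψ X)) (cellN (n + 1) ℓ) :=
    integrableOn_weight_conj_mul hmm hmb j hP hQ
  rw [← integral_finsetSum _ hI, Complex.real_smul, ← integral_const_mul, ← integral_const_mul,
    ← integral_sub ((integrable_finsetSum _ hI).const_mul _) (hI0.const_mul _)]
  refine integral_congr_ae (Eventually.of_forall fun X => ?_)
  have e1 : (∑ i ∈ Finset.univ.erase j, ((∫ y in cell ℓ, w y (X j) : ℝ) : ℂ) *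
      (conj (sliceMean ℓ i (sliceMean ℓ j Ψ) X) * sliceFluct ℓ j Ψ X)) =
      ((∫ y in cell ℓ, w y (X j) : ℝ) : ℂ) * (conj (∑ i ∈ Finset.univ.erase j,
        sliceMean ℓ i (sliceMean ℓ j Ψ) X) * sliceFluct ℓ j Ψ X) := by
    rw [map_sum, Finset.sum_mul, Finset.mul_sum]
  dsimp only
  rw [e1, map_sub, map_mul, map_mul, Complex.conj_ofReal, Complex.conj_ofReal]
  ring

/-- **[LiebSolovej2001, Lemma 5.5] (control of the terms with `ŵ_{p0,00}`), first-quantized expectation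
form for particle `j`.** For `ℓ > 0`, a symmetric bounded measurable pair weight `0 ≤ w ≤ W_b` with
`m(x) = ∫_Λ w(y,x)dy`, a continuous `(n+1)`-body function `Ψ`, `ρ ∈ ℝ` and `ε > 0`:
`|∑_{i≠j}Re∫w conj(PᵢPⱼΨ)(PᵢQⱼΨ) - ρRe∫m conj(PⱼΨ)QⱼΨ| ≤ ½(εℓ⁻³(∫_Λ m)‖Aⱼ‖² + ε⁻¹∫m(xⱼ)|QⱼΨ|²)`,
`Aⱼ = ℓ⁻³∑_{i≠j}PᵢPⱼΨ - ρPⱼΨ` (the printed `εŵ_{00,00}(n̂₀+1-ρℓ³)²` and `ε⁻¹·4πR²·n̂₊`-type errors, all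
norms in `L²(Λⁿ⁺¹)`). [cite: LiebSolovej2001, Lemma 5.5] -/
theorem ls_lemma55 (hℓ : 0 < ℓ) (j : Fin (n + 1)) (hw : Measurable (Function.uncurry w))
    (hw0 : ∀ x y, 0 ≤ w x y) {Wb : ℝ} (hWb : ∀ x y, |w x y| ≤ Wb) (hΨ : Continuous Ψ) (ρ : ℝ)
    {ε : ℝ} (hε : 0 < ε) :
    |(∑ i ∈ Finset.univ.erase j, ∫ X in cellN (n + 1) ℓ, (w (X i) (X j) : ℂ) *
          (conj (sliceMean ℓ i (sliceMean ℓ j Ψ) X) * sliceMean ℓ i (sliceFluct ℓ j Ψ) X)).re -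
        ρ * (∫ X in cellN (n + 1) ℓ, ((∫ y in cell ℓ, w y (X j) : ℝ) : ℂ) *
          (conj (sliceMean ℓ j Ψ X) * sliceFluct ℓ j Ψ X)).re| ≤
      1 / 2 * (ε * ((ℓ ^ 3)⁻¹ * (∫ y in cell ℓ, ∫ y' in cell ℓ, w y' y) *
          (∫⁻ X in cellN (n + 1) ℓ, (‖(((ℓ ^ 3)⁻¹ : ℝ) : ℂ) *
            (∑ i ∈ Finset.univ.erase j, sliceMean ℓ i (sliceMean ℓ j Ψ) X) -
              (ρ : ℂ) * sliceMean ℓ j Ψ X‖₊ : ℝ≥0∞) ^ 2).toReal) +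
        ε⁻¹ * (∫⁻ X in cellN (n + 1) ℓ, ENNReal.ofReal (∫ y in cell ℓ, w y (X j)) *
          (‖sliceFluct ℓ j Ψ X‖₊ : ℝ≥0∞) ^ 2).toReal) := by
  obtain ⟨hmm, hm0, hmb⟩ := column_weight_props hℓ.le hw hw0 hWb
  set m : Space → ℝ := fun x => ∫ y in cell ℓ, w y x with hmdef
  set A : Config (n + 1) → ℂ := fun X => (((ℓ ^ 3)⁻¹ : ℝ) : ℂ) *
    (∑ i ∈ Finset.univ.erase j, sliceMean ℓ i (sliceMean ℓ j Ψ) X) - (ρ : ℂ) * sliceMean ℓ j Ψ X with hA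
  have hP : Continuous (sliceMean ℓ j Ψ) := continuous_sliceMean ℓ j hΨ
  have hQ : Continuous (sliceFluct ℓ j Ψ) := continuous_sliceFluct ℓ j hΨ
  have hAc : Continuous A := by
    refine (continuous_const.mul (continuous_finsetSum _ fun i _ => continuous_sliceMean ℓ i hP)).sub
      (continuous_const.mul hP)
  have hAj : ∀ X z, A (Function.update X j z) = A X := fun X z => by
    simp only [hA, sliceMean_update, Finset.sum_congr rfl fun i _ => sliceMean_sliceMean_update ℓ i j hΨ X z]
  -- the combination
  have hcomb := one_Q_combination hℓ j hw hw0 hWb hΨ ρ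
  have hre : (∑ i ∈ Finset.univ.erase j, ∫ X in cellN (n + 1) ℓ, (w (X i) (X j) : ℂ) *
        (conj (sliceMean ℓ i (sliceMean ℓ j Ψ) X) * sliceMean ℓ i (sliceFluct ℓ j Ψ) X)).re -
      ρ * (∫ X in cellN (n + 1) ℓ, (m (X j) : ℂ) * (conj (sliceMean ℓ j Ψ X) * sliceFluct ℓ j Ψ X)).re =
      (∫ X in cellN (n + 1) ℓ, (m (X j) : ℂ) * (conj (A X) * sliceFluct ℓ j Ψ X)).re := by
    have h := congrArg Complex.re hcomb
    rwa [Complex.sub_re, Complex.re_ofReal_mul] at h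
  rw [hre]
  -- `|Re ∫ m conj(A) Q| ≤ (∫⁻ m‖A‖‖Q‖).toReal`
  have hcross : |(∫ X in cellN (n + 1) ℓ, (m (X j) : ℂ) * (conj (A X) * sliceFluct ℓ j Ψ X)).re| ≤
      (∫⁻ X in cellN (n + 1) ℓ, ENNReal.ofReal (m (X j)) * ((‖A X‖₊ : ℝ≥0∞) * ‖sliceFluct ℓ j Ψ X‖₊)).toReal := by
    have hint := integrableOn_weight_conj_mul (ℓ := ℓ) hmm hmb j hAc hQ
    have hre2 : (∫ X in cellN (n + 1) ℓ, (m (X j) : ℂ) * (conj (A X) * sliceFluct ℓ j Ψ X)).re =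
        ∫ X in cellN (n + 1) ℓ, m (X j) * (conj (A X) * sliceFluct ℓ j Ψ X).re := by
      have h := Complex.reCLM.integral_comp_comm hint
      simp only [Complex.reCLM_apply] at h
      rw [← h]
      refine integral_congr_ae (Eventually.of_forall fun X => ?_)
      simp only [Complex.re_ofReal_mul]
    rw [hre2]
    exact abs_background_cross_le_toReal hmm hm0 hmb j hAc hQ
  -- Cauchy–Schwarz in `ℝ≥0∞`
  have hεE : ENNReal.ofReal ε ≠ 0 := by rwa [Ne, ENNReal.ofReal_eq_zero, not_le]
  have hεE' : ENNReal.ofReal ε ≠ ⊤ := ENNReal.ofReal_ne_top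
  have hεinv : (ENNReal.ofReal ε)⁻¹ = ENNReal.ofReal ε⁻¹ := (ENNReal.ofReal_inv_of_pos hε).symm
  have hWm : Measurable fun X : Config (n + 1) => ENNReal.ofReal (m (X j)) :=
    ENNReal.measurable_ofReal.comp (hmm.comp (measurable_pi_apply j))
  have hcs := two_lintegral_weight_mul_mul_le (μ := volume.restrict (cellN (n + 1) ℓ)) hWm
    hAc.measurable hQ.measurable hεE hεE'
  -- the `A`-term: dummy integration of `xⱼ`
  have hg : Measurable (Function.uncurry fun (_ : Config (n + 1)) (y : Space) => ENNReal.ofReal (m y)) :=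
    ENNReal.measurable_ofReal.comp (hmm.comp measurable_snd)
  have hdum := lintegral_cellN_weight_of_update_invariant hℓ j (g := fun _ y => ENNReal.ofReal (m y)) hg
    (fun _ _ _ => rfl) hAc.measurable hAj
  -- finiteness
  have hL3 : ENNReal.ofReal ℓ ^ 3 ≠ 0 := pow_ne_zero _ (by simpa using hℓ)
  haveI := isFiniteMeasure_restrict_cell ℓ
  have hmint : IntegrableOn m (cell ℓ) := integrableOn_cell_of_bounded hmm hmb ℓ
  have hMcell : (∫⁻ y in cell ℓ, ENNReal.ofReal (m y)) = ENNReal.ofReal (∫ y in cell ℓ, m y) :=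
    (ofReal_integral_eq_lintegral_ofReal hmint (Eventually.of_forall hm0)).symm
  have hAtop : (∫⁻ X in cellN (n + 1) ℓ, (‖A X‖₊ : ℝ≥0∞) ^ 2) ≠ ⊤ := (setLIntegral_cellN_normSq_lt_top hAc ℓ).ne
  have hAm2 : Measurable fun X : Config (n + 1) => (‖A X‖₊ : ℝ≥0∞) ^ 2 :=
    hAc.measurable.nnnorm.coe_nnreal_ennreal.pow_const _
  have hdum' : (∫⁻ X in cellN (n + 1) ℓ, ENNReal.ofReal (m (X j)) * (‖A X‖₊ : ℝ≥0∞) ^ 2) =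
      (ENNReal.ofReal ℓ ^ 3)⁻¹ * (ENNReal.ofReal (∫ y in cell ℓ, m y) *
        ∫⁻ X in cellN (n + 1) ℓ, (‖A X‖₊ : ℝ≥0∞) ^ 2) := by
    rw [hdum, hMcell, lintegral_const_mul _ hAm2]
  have hWAtop : (∫⁻ X in cellN (n + 1) ℓ, ENNReal.ofReal (m (X j)) * (‖A X‖₊ : ℝ≥0∞) ^ 2) ≠ ⊤ := by
    rw [hdum']
    exact ENNReal.mul_ne_top (ENNReal.inv_ne_top.2 hL3) (ENNReal.mul_ne_top ENNReal.ofReal_ne_top hAtop)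
  have hWQtop : (∫⁻ X in cellN (n + 1) ℓ, ENNReal.ofReal (m (X j)) * (‖sliceFluct ℓ j Ψ X‖₊ : ℝ≥0∞) ^ 2) ≠ ⊤ := by
    have h := setLIntegral_cellN_weight_normSq_lt_top hQ ℓ (m := fun x => ENNReal.ofReal (m x))
      (M := ENNReal.ofReal (Wb * ℓ ^ 3)) ENNReal.ofReal_ne_top
      (fun x => ENNReal.ofReal_le_ofReal ((le_abs_self _).trans (hmb x))) j
    exact h.ne
  have hWA' : ENNReal.ofReal ε * (∫⁻ X in cellN (n + 1) ℓ, ENNReal.ofReal (m (X j)) * (‖A X‖₊ : ℝ≥0∞) ^ 2) ≠ ⊤ :=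
    ENNReal.mul_ne_top hεE' hWAtop
  have hWQ' : (ENNReal.ofReal ε)⁻¹ * (∫⁻ X in cellN (n + 1) ℓ, ENNReal.ofReal (m (X j)) *
      (‖sliceFluct ℓ j Ψ X‖₊ : ℝ≥0∞) ^ 2) ≠ ⊤ := by
    rw [hεinv]; exact ENNReal.mul_ne_top ENNReal.ofReal_ne_top hWQtop
  have hr := ENNReal.toReal_mono (ENNReal.add_ne_top.2 ⟨hWA', hWQ'⟩) hcs
  -- conversions to real numbers
  have t1 : (2 * ∫⁻ X in cellN (n + 1) ℓ, ENNReal.ofReal (m (X j)) *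
      ((‖A X‖₊ : ℝ≥0∞) * ‖sliceFluct ℓ j Ψ X‖₊)).toReal =
      2 * (∫⁻ X in cellN (n + 1) ℓ, ENNReal.ofReal (m (X j)) * ((‖A X‖₊ : ℝ≥0∞) * ‖sliceFluct ℓ j Ψ X‖₊)).toReal := by
    rw [ENNReal.toReal_mul, ENNReal.toReal_ofNat]
  have t2 : (ENNReal.ofReal ε * (∫⁻ X in cellN (n + 1) ℓ, ENNReal.ofReal (m (X j)) * (‖A X‖₊ : ℝ≥0∞) ^ 2) +
      (ENNReal.ofReal ε)⁻¹ * ∫⁻ X in cellN (n + 1) ℓ, ENNReal.ofReal (m (X j)) *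
        (‖sliceFluct ℓ j Ψ X‖₊ : ℝ≥0∞) ^ 2).toReal =
      ε * ((ℓ ^ 3)⁻¹ * ((∫ y in cell ℓ, m y) * (∫⁻ X in cellN (n + 1) ℓ, (‖A X‖₊ : ℝ≥0∞) ^ 2).toReal)) +
        ε⁻¹ * (∫⁻ X in cellN (n + 1) ℓ, ENNReal.ofReal (m (X j)) * (‖sliceFluct ℓ j Ψ X‖₊ : ℝ≥0∞) ^ 2).toReal := by
    rw [ENNReal.toReal_add hWA' hWQ', ENNReal.toReal_mul, ENNReal.toReal_ofReal hε.le, hεinv,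
      ENNReal.toReal_mul, ENNReal.toReal_ofReal (inv_nonneg.2 hε.le), hdum', ENNReal.toReal_mul,
      ENNReal.toReal_mul, ENNReal.toReal_inv, ENNReal.toReal_pow, ENNReal.toReal_ofReal hℓ.le,
      ENNReal.toReal_ofReal (integral_nonneg hm0)]
  rw [t1, t2] at hr
  -- assemble
  have hmdef' : (∫ y in cell ℓ, m y) = ∫ y in cell ℓ, ∫ y' in cell ℓ, w y' y := rfl
  rw [← hmdef']
  nlinarith [hcross, hr, hε]

end OneQ

end Literature.MathematicalPhysics.QuantumManyBody.JelliumBoseGas
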